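import Mathlib
import Summits.Ventures.PercRepro2.CutSideMasses
import Summits.Ventures.PercRepro2.CutLeafRow
import Summits.Ventures.PercRepro2.LeafAA0
import Summits.Ventures.PercRepro2.ClusterThreeMark

/-!
# Row (LEAF-½) across a cut vertex separating `{a₁, b, o}` from `{a₂, v}`: (AA0) holds, so the
witness of `AA0Witness.lean` needs its two bridges (blind cell PercRepro2, p5 g27;
`proofs/P5-OEDGE.md` §35 addendum 3)

Let `z` be a cut vertex with `a₁, b, o ∈ VA` and `a₂, v ∈ VB` — the placement of the (AA0) witness
`W7e9`, with ONE cut vertex in place of its two weak bridges.  Under `Q = {a₁ ↮ a₂}` the `A`-side law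
is, given the `B`-side, one of TWO positively associated laws — the unconditioned one (world `z ↮ a₂`)
or the one conditioned on `a₁ ↮ z` (world `z ↔ a₂`) — and the `Q`-means `β, l` of `b, o ∈ C₁` are
convex combinations of the two laws' means.  Hence the shift products of the two worlds have the
same sign, and the cleared `(A)`-term satisfies the exact identity

  `crossA · P_A(a₁ ↮ z) = P(Q)² · P_A(a₁ ↮ z) · P_B(v ↔ a₂, z ↮ a₂) · C₀ + P(Q)² · P_B(v ↔ a₂, z ↔ a₂) · C₁ + S · (…)`

(`crossA_mul_eq`) with `C₀` the Harris slack of `b, o ∈ C_A(a₁)`, `C₁` the BHK06 Thm 1.2 slack under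
the avoidance `a₁ ↮ z` (`bhk_same_cluster_events`), `S` the product of the two avoidance-monotonicity
slacks `P_A(a₁↮z)·P_A(a₁↔b) − P_A(a₁↔b, a₁↮z) ≥ 0` (`ClusterThreeMark.bhk_avoid_mono_event`), and
`(…) ≥ 0`; so `0 ≤ crossA` (`crossA_nonneg_of_cut`).  The mirror term is a product of three masses
(`crossA'_eq`), so `0 ≤ crossAA` (`crossAA_nonneg_of_cut`) and row (LEAF-½) holds
(`LeafRow_of_cut_AAB`, by `LeafAA0.LeafRow_of_AA0`).  The witness `W7e9` of `AA0Witness.lean`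
has two bridges: there the `A`-side law given the `B`-side takes four values, pulling `b` and `o` in
different directions — exactly what this theorem excludes.  Nothing here is claimed off the class.
-/

namespace Summit.Ventures.PercRepro2

open UnionCluster CovForm PendantRoot LeafStep LeafHalfCross CutLeafRow

namespace CutLeafRowAAB

variable {V : Type*} {E : Type*} [Fintype E] [DecidableEq E] [Fintype V] [DecidableEq V]
  {R : Type*} [Field R] [LinearOrder R] [IsStrictOrderedRing R]

variable (p : E → R) (ends : E → Sym2 V) {z : V} {VA VB : Set V} {EA EB : Set E}
  [DecidablePred (· ∈ EA)] [DecidablePred (· ∈ EB)]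

omit [Fintype V] [DecidableEq V] [LinearOrder R] [IsStrictOrderedRing R] in
/-- `P(Q, vH, oL, bL)` with `o, b ∈ VA`, `v ∈ VB`. -/
lemma mass_vHoLbL_AA (h : CutV.IsCut ends z VA VB EA EB) {a₁ a₂ b o v : V} (ha₁ : a₁ ∈ VA)
    (hb : b ∈ VA) (ho : o ∈ VA) (ha₂ : a₂ ∈ VB) (hv : v ∈ VB) :
    prob p (avoidAll ends a₂ {a₁} ∩
        (connEvent ends a₂ v ∩ (connEvent ends a₁ o ∩ connEvent ends a₁ b))) =
      prob p (CutV.sideEvent EA (connEvent ends a₁ o ∩ connEvent ends a₁ b)) *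
          prob p (CutV.sideEvent EB (connEvent ends a₂ v)) -
        prob p (CutV.sideEvent EA (connEvent ends a₁ o ∩ connEvent ends a₁ b ∩
            connEvent ends a₁ z)) *
          prob p (CutV.sideEvent EB (connEvent ends a₂ v ∩ connEvent ends a₂ z)) :=
  mass_of_sides p ends h ha₁ ha₂
    (X := connEvent ends a₂ v ∩ (connEvent ends a₁ o ∩ connEvent ends a₁ b))
    (connEvent ends a₁ o ∩ connEvent ends a₁ b) (connEvent ends a₂ v) (by
    ext ω
    simp only [Set.mem_inter_iff, CutV.mem_sideEvent]
    rw [memB h ha₂ hv ω, memA h ha₁ ho ω, memA h ha₁ hb ω]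
    tauto)

omit [Fintype V] [DecidableEq V] [LinearOrder R] [IsStrictOrderedRing R] in
/-- `P(Q, vL, oH, bH) = 0` with `o, b ∈ VA`, `v ∈ VB`. -/
lemma mass_vLoHbH_AA (h : CutV.IsCut ends z VA VB EA EB) {a₁ a₂ b o v : V} (ha₁ : a₁ ∈ VA)
    (hb : b ∈ VA) (ho : o ∈ VA) (ha₂ : a₂ ∈ VB) (hv : v ∈ VB) :
    prob p (avoidAll ends a₂ {a₁} ∩
      (connEvent ends a₁ v ∩ (connEvent ends a₂ o ∩ connEvent ends a₂ b))) = 0 :=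
  mass_zero p ends h ha₁ ha₂ (connEvent ends o z ∩ connEvent ends b z) (connEvent ends v z) (by
    ext ω
    simp only [Set.mem_inter_iff, CutV.mem_sideEvent]
    rw [memAB h ha₁ hv ω, memBA h ha₂ ho ω, memBA h ha₂ hb ω]
    tauto)

omit [Fintype V] [DecidableEq V] [LinearOrder R] [IsStrictOrderedRing R] in
/-- `P(Q, vL, oH) = 0` with `o ∈ VA`, `v ∈ VB` (and the same with `b`). -/
lemma mass_vLoH_AA (h : CutV.IsCut ends z VA VB EA EB) {a₁ a₂ o v : V} (ha₁ : a₁ ∈ VA)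
    (ho : o ∈ VA) (ha₂ : a₂ ∈ VB) (hv : v ∈ VB) :
    prob p (avoidAll ends a₂ {a₁} ∩ (connEvent ends a₁ v ∩ connEvent ends a₂ o)) = 0 :=
  mass_zero p ends h ha₁ ha₂ (connEvent ends o z) (connEvent ends v z) (by
    ext ω
    simp only [Set.mem_inter_iff, CutV.mem_sideEvent]
    rw [memAB h ha₁ hv ω, memBA h ha₂ ho ω]
    tauto)

omit [Fintype V] [DecidableEq V] [LinearOrder R] [IsStrictOrderedRing R] in
/-- **The mirror term is a product of three masses**:
`crossA′ = P(Q, oH)·P(Q, vL)·P(Q, bH)` (every term with two `C₂`-marks and `v ∈ C₁` vanishes). -/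
theorem crossA'_eq (h : CutV.IsCut ends z VA VB EA EB) {a₁ a₂ b o v : V} (ha₁ : a₁ ∈ VA)
    (hb : b ∈ VA) (ho : o ∈ VA) (ha₂ : a₂ ∈ VB) (hv : v ∈ VB) :
    crossA p ends o a₂ a₁ v b =
      prob p (avoidAll ends a₂ {a₁} ∩ connEvent ends a₂ o) *
        (prob p (avoidAll ends a₂ {a₁} ∩ connEvent ends a₁ v) *
          prob p (avoidAll ends a₂ {a₁} ∩ connEvent ends a₂ b)) := by
  unfold crossA anticov
  simp only [avoidAll_root_swap ends a₁ a₂]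
  rw [mass_vLoHbH_AA p ends h ha₁ hb ho ha₂ hv, mass_vLoH_AA p ends h ha₁ ho ha₂ hv,
    mass_vLoH_AA p ends h ha₁ hb ha₂ hv]
  ring

omit [Fintype V] [DecidableEq V] [LinearOrder R] [IsStrictOrderedRing R] in
/-- **The exact decomposition of `crossA`** (all side masses; `C₀`, `C₁`, `S` as in the header):
`crossA · P_A(a₁ ↮ z) = P(Q)²·P_A(a₁ ↮ z)·P_B(vH, z ↮ a₂)·C₀ + P(Q)²·P_B(vH, z ↔ a₂)·C₁
 + S·(P_B(vH, z ↮ a₂)·P_B(a₂ ↔ z)²·P_A(a₁ ↮ z) + P_B(vH, z ↔ a₂)·(1 − P_B(a₂ ↔ z))²)`. -/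
theorem crossA_mul_eq (h : CutV.IsCut ends z VA VB EA EB) {a₁ a₂ b o v : V} (ha₁ : a₁ ∈ VA)
    (hb : b ∈ VA) (ho : o ∈ VA) (ha₂ : a₂ ∈ VB) (hv : v ∈ VB) :
    crossA p ends o a₁ a₂ v b * (1 - prob p (CutV.sideEvent EA (connEvent ends a₁ z))) =
      (1 - prob p (CutV.sideEvent EA (connEvent ends a₁ z)) *
            prob p (CutV.sideEvent EB (connEvent ends a₂ z))) ^ 2 *
          (1 - prob p (CutV.sideEvent EA (connEvent ends a₁ z))) *
          (prob p (CutV.sideEvent EB (connEvent ends a₂ v)) -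
            prob p (CutV.sideEvent EB (connEvent ends a₂ v ∩ connEvent ends a₂ z))) *
          (prob p (CutV.sideEvent EA (connEvent ends a₁ o ∩ connEvent ends a₁ b)) -
            prob p (CutV.sideEvent EA (connEvent ends a₁ b)) *
              prob p (CutV.sideEvent EA (connEvent ends a₁ o))) +
        (1 - prob p (CutV.sideEvent EA (connEvent ends a₁ z)) *
            prob p (CutV.sideEvent EB (connEvent ends a₂ z))) ^ 2 *
          prob p (CutV.sideEvent EB (connEvent ends a₂ v ∩ connEvent ends a₂ z)) *
          ((1 - prob p (CutV.sideEvent EA (connEvent ends a₁ z))) *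
              (prob p (CutV.sideEvent EA (connEvent ends a₁ o ∩ connEvent ends a₁ b)) -
                prob p (CutV.sideEvent EA (connEvent ends a₁ o ∩ connEvent ends a₁ b ∩
                  connEvent ends a₁ z))) -
            (prob p (CutV.sideEvent EA (connEvent ends a₁ b)) -
                prob p (CutV.sideEvent EA (connEvent ends a₁ b ∩ connEvent ends a₁ z))) *
              (prob p (CutV.sideEvent EA (connEvent ends a₁ o)) -
                prob p (CutV.sideEvent EA (connEvent ends a₁ o ∩ connEvent ends a₁ z)))) +
        ((1 - prob p (CutV.sideEvent EA (connEvent ends a₁ z))) *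
              prob p (CutV.sideEvent EA (connEvent ends a₁ b)) -
            (prob p (CutV.sideEvent EA (connEvent ends a₁ b)) -
              prob p (CutV.sideEvent EA (connEvent ends a₁ b ∩ connEvent ends a₁ z)))) *
          ((1 - prob p (CutV.sideEvent EA (connEvent ends a₁ z))) *
              prob p (CutV.sideEvent EA (connEvent ends a₁ o)) -
            (prob p (CutV.sideEvent EA (connEvent ends a₁ o)) -
              prob p (CutV.sideEvent EA (connEvent ends a₁ o ∩ connEvent ends a₁ z)))) *
          ((prob p (CutV.sideEvent EB (connEvent ends a₂ v)) -
                prob p (CutV.sideEvent EB (connEvent ends a₂ v ∩ connEvent ends a₂ z))) *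
              prob p (CutV.sideEvent EB (connEvent ends a₂ z)) ^ 2 *
              (1 - prob p (CutV.sideEvent EA (connEvent ends a₁ z))) +
            prob p (CutV.sideEvent EB (connEvent ends a₂ v ∩ connEvent ends a₂ z)) *
              (1 - prob p (CutV.sideEvent EB (connEvent ends a₂ z))) ^ 2) := by
  unfold crossA anticov
  rw [mass_Q p ends h ha₁ ha₂, mass_vHoLbL_AA p ends h ha₁ hb ho ha₂ hv,
    mass_bL p ends h ha₁ hb ha₂, mass_oHbL p ends h ha₁ ho ha₂ hv, mass_bL p ends h ha₁ ho ha₂,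
    mass_oH p ends h ha₁ ha₂ hv, mass_oHbL p ends h ha₁ hb ha₂ hv]
  ring

/-! ## The signs -/

section Signs

variable (EA : Set E) [DecidablePred (· ∈ EA)]

omit [Fintype V] [DecidableEq V] [LinearOrder R] [IsStrictOrderedRing R] in
/-- A side mass as a whole-graph mass under the weights with the other side closed. -/
lemma sideA_eq (X : Set (Config E)) :
    prob p (CutV.sideEvent EA X) = prob (fun e => if e ∈ EA then p e else 0) X :=
  (CDCutVertex.prob_zeroOff_eq_prob_sideEvent p EA X).symm

omit [Fintype V] [DecidableEq V] in
/-- **Harris on the `A`-side**: `0 ≤ C₀`. -/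
lemma C0_nonneg (hp : IsProbVec p) (a₁ b o : V) :
    0 ≤ prob p (CutV.sideEvent EA (connEvent ends a₁ o ∩ connEvent ends a₁ b)) -
      prob p (CutV.sideEvent EA (connEvent ends a₁ b)) *
        prob p (CutV.sideEvent EA (connEvent ends a₁ o)) := by
  rw [sideA_eq, sideA_eq, sideA_eq]
  have := prob_mul_prob_le_prob_inter (CDCutVertex.isProbVec_zeroOff hp EA)
    (isUpperSet_connEvent ends a₁ o) (isUpperSet_connEvent ends a₁ b)
  linarith [this, mul_comm (prob (fun e => if e ∈ EA then p e else 0) (connEvent ends a₁ o))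
    (prob (fun e => if e ∈ EA then p e else 0) (connEvent ends a₁ b))]

/-- **BHK06 Thm 1.2 on the `A`-side under the avoidance `a₁ ↮ z`**: `0 ≤ C₁`. -/
lemma C1_nonneg (hp : IsProbVec p) (a₁ b o z : V) :
    0 ≤ (1 - prob p (CutV.sideEvent EA (connEvent ends a₁ z))) *
        (prob p (CutV.sideEvent EA (connEvent ends a₁ o ∩ connEvent ends a₁ b)) -
          prob p (CutV.sideEvent EA (connEvent ends a₁ o ∩ connEvent ends a₁ b ∩
            connEvent ends a₁ z))) -
      (prob p (CutV.sideEvent EA (connEvent ends a₁ b)) -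
          prob p (CutV.sideEvent EA (connEvent ends a₁ b ∩ connEvent ends a₁ z))) *
        (prob p (CutV.sideEvent EA (connEvent ends a₁ o)) -
          prob p (CutV.sideEvent EA (connEvent ends a₁ o ∩ connEvent ends a₁ z))) := by
  have hc := side_compl p EA (connEvent ends a₁ o ∩ connEvent ends a₁ b) (connEvent ends a₁ z)
  have hb' := side_compl p EA (connEvent ends a₁ b) (connEvent ends a₁ z)
  have ho' := side_compl p EA (connEvent ends a₁ o) (connEvent ends a₁ z)
  have hz := prob_compl p (CutV.sideEvent EA (connEvent ends a₁ z))
  have hz' : (CutV.sideEvent EA (connEvent ends a₁ z))ᶜ =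
      CutV.sideEvent EA (connEvent ends a₁ z)ᶜ := rfl
  rw [← hc, ← hb', ← ho', ← hz, hz', sideA_eq, sideA_eq, sideA_eq, sideA_eq]
  have key := bhk_same_cluster_events (fun e => if e ∈ EA then p e else 0)
    (CDCutVertex.isProbVec_zeroOff hp EA) ends a₁ z (isUpperSet_mem_setOf o) (isUpperSet_mem_setOf b)
  rw [← connEvent_eq_clusterInEvent ends a₁ o, ← connEvent_eq_clusterInEvent ends a₁ b] at key
  linarith

/-- **Avoidance monotonicity on the `A`-side**: `P_A(a₁ ↔ b, a₁ ↮ z) ≤ P_A(a₁ ↔ b)·P_A(a₁ ↮ z)`,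
one factor of `S`. -/
lemma S_factor_nonneg (hp : IsProbVec p) (a₁ b z : V) :
    0 ≤ (1 - prob p (CutV.sideEvent EA (connEvent ends a₁ z))) *
        prob p (CutV.sideEvent EA (connEvent ends a₁ b)) -
      (prob p (CutV.sideEvent EA (connEvent ends a₁ b)) -
        prob p (CutV.sideEvent EA (connEvent ends a₁ b ∩ connEvent ends a₁ z))) := by
  have hb' := side_compl p EA (connEvent ends a₁ b) (connEvent ends a₁ z)
  have hz := prob_compl p (CutV.sideEvent EA (connEvent ends a₁ z))
  have hz' : (CutV.sideEvent EA (connEvent ends a₁ z))ᶜ =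
      CutV.sideEvent EA (connEvent ends a₁ z)ᶜ := rfl
  rw [← hb', ← hz, hz', sideA_eq, sideA_eq, sideA_eq]
  have key := ClusterThreeMark.bhk_avoid_mono_event (fun e => if e ∈ EA then p e else 0) ends
    (CDCutVertex.isProbVec_zeroOff hp EA) a₁ b (X := ∅) (X' := {z}) (Finset.empty_subset _)
  rw [ClusterThreeMark.avoidAll_singleton_eq, ClusterOutsideMark.avoidAll_empty, Set.inter_univ,
    prob_univ, mul_one] at key
  linarith

end Signs

/-! ## The theorem -/

/-- **`0 ≤ crossA` across a cut vertex separating `{a₁, b, o}` from `{a₂, v}`.** -/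
theorem crossA_nonneg_of_cut (hp : IsProbVec p) (h : CutV.IsCut ends z VA VB EA EB)
    {a₁ a₂ b o v : V} (ha₁ : a₁ ∈ VA) (hb : b ∈ VA) (ho : o ∈ VA) (ha₂ : a₂ ∈ VB) (hv : v ∈ VB) :
    0 ≤ crossA p ends o a₁ a₂ v b := by
  have hid := crossA_mul_eq p ends h ha₁ hb ho ha₂ hv
  have hα1 := prob_le_one hp (CutV.sideEvent EA (connEvent ends a₁ z))
  have hα0 := prob_nonneg hp (CutV.sideEvent EA (connEvent ends a₁ z))
  have hγ0 := prob_nonneg hp (CutV.sideEvent EB (connEvent ends a₂ z))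
  have hγ1 := prob_le_one hp (CutV.sideEvent EB (connEvent ends a₂ z))
  have hn1 := prob_nonneg hp (CutV.sideEvent EB (connEvent ends a₂ v ∩ connEvent ends a₂ z))
  have hn0 : 0 ≤ prob p (CutV.sideEvent EB (connEvent ends a₂ v)) -
      prob p (CutV.sideEvent EB (connEvent ends a₂ v ∩ connEvent ends a₂ z)) := by
    have := side_mono p EB hp (X := connEvent ends a₂ v ∩ connEvent ends a₂ z)
      (Y := connEvent ends a₂ v) Set.inter_subset_left
    linarith
  have hC0 := C0_nonneg p ends EA hp a₁ b o
  have hC1 := C1_nonneg p ends EA hp a₁ b o z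
  have hSb := S_factor_nonneg p ends EA hp a₁ b z
  have hSo := S_factor_nonneg p ends EA hp a₁ o z
  have hZ0 : 0 ≤ 1 - prob p (CutV.sideEvent EA (connEvent ends a₁ z)) *
      prob p (CutV.sideEvent EB (connEvent ends a₂ z)) := by nlinarith
  set α := prob p (CutV.sideEvent EA (connEvent ends a₁ z)) with hαdef
  set γ := prob p (CutV.sideEvent EB (connEvent ends a₂ z)) with hγdef
  set n₁ := prob p (CutV.sideEvent EB (connEvent ends a₂ v ∩ connEvent ends a₂ z)) with hn₁def
  set n₀ := prob p (CutV.sideEvent EB (connEvent ends a₂ v)) - n₁ with hn₀def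
  set C₀ := prob p (CutV.sideEvent EA (connEvent ends a₁ o ∩ connEvent ends a₁ b)) -
    prob p (CutV.sideEvent EA (connEvent ends a₁ b)) *
      prob p (CutV.sideEvent EA (connEvent ends a₁ o)) with hC₀def
  set C₁ := (1 - α) *
      (prob p (CutV.sideEvent EA (connEvent ends a₁ o ∩ connEvent ends a₁ b)) -
        prob p (CutV.sideEvent EA (connEvent ends a₁ o ∩ connEvent ends a₁ b ∩
          connEvent ends a₁ z))) -
    (prob p (CutV.sideEvent EA (connEvent ends a₁ b)) -
        prob p (CutV.sideEvent EA (connEvent ends a₁ b ∩ connEvent ends a₁ z))) *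
      (prob p (CutV.sideEvent EA (connEvent ends a₁ o)) -
        prob p (CutV.sideEvent EA (connEvent ends a₁ o ∩ connEvent ends a₁ z))) with hC₁def
  set Sb := (1 - α) * prob p (CutV.sideEvent EA (connEvent ends a₁ b)) -
    (prob p (CutV.sideEvent EA (connEvent ends a₁ b)) -
      prob p (CutV.sideEvent EA (connEvent ends a₁ b ∩ connEvent ends a₁ z))) with hSbdef
  set So := (1 - α) * prob p (CutV.sideEvent EA (connEvent ends a₁ o)) -
    (prob p (CutV.sideEvent EA (connEvent ends a₁ o)) -
      prob p (CutV.sideEvent EA (connEvent ends a₁ o ∩ connEvent ends a₁ z))) with hSodef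
  have hZ0 : 0 ≤ 1 - α * γ := by nlinarith
  have hrhs : 0 ≤ crossA p ends o a₁ a₂ v b * (1 - α) := by
    rw [hid]
    have t1 : 0 ≤ (1 - α * γ) ^ 2 * (1 - α) * n₀ * C₀ :=
      mul_nonneg (mul_nonneg (mul_nonneg (pow_nonneg hZ0 2) (sub_nonneg.2 hα1)) hn0) hC0
    have t2 : 0 ≤ (1 - α * γ) ^ 2 * n₁ * C₁ := mul_nonneg (mul_nonneg (pow_nonneg hZ0 2) hn1) hC1
    have t3 : 0 ≤ Sb * So * (n₀ * γ ^ 2 * (1 - α) + n₁ * (1 - γ) ^ 2) :=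
      mul_nonneg (mul_nonneg hSb hSo)
        (add_nonneg (mul_nonneg (mul_nonneg hn0 (sq_nonneg γ)) (sub_nonneg.2 hα1))
          (mul_nonneg hn1 (sq_nonneg (1 - γ))))
    linarith
  rcases (sub_nonneg.2 hα1).lt_or_eq with hpos | hzero
  · exact le_of_mul_le_mul_right (by rw [zero_mul]; exact hrhs) hpos
  · -- the corner `P_A(a₁ ↔ z) = 1`: every `A`-mass inside `{a₁ ↮ z}` vanishes and
    -- `crossA = P(Q)²·P_B(vH, z ↮ a₂)·C₀`
    have hα : prob p (CutV.sideEvent EA (connEvent ends a₁ z)) = 1 := by linarith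
    have hzc : prob p (CutV.sideEvent EA (connEvent ends a₁ z)ᶜ) = 0 := by
      have := prob_compl p (CutV.sideEvent EA (connEvent ends a₁ z))
      have e : (CutV.sideEvent EA (connEvent ends a₁ z))ᶜ =
          CutV.sideEvent EA (connEvent ends a₁ z)ᶜ := rfl
      rw [e] at this
      linarith
    have vanish : ∀ X : Set (Config E), prob p (CutV.sideEvent EA (X ∩ connEvent ends a₁ z)) =
        prob p (CutV.sideEvent EA X) := by
      intro X
      have hc := side_compl p EA X (connEvent ends a₁ z)
      have h0 : prob p (CutV.sideEvent EA (X ∩ (connEvent ends a₁ z)ᶜ)) = 0 :=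
        le_antisymm (by
          calc prob p (CutV.sideEvent EA (X ∩ (connEvent ends a₁ z)ᶜ))
              ≤ prob p (CutV.sideEvent EA (connEvent ends a₁ z)ᶜ) :=
                side_mono p EA hp Set.inter_subset_right
            _ = 0 := hzc) (prob_nonneg hp _)
      linarith
    have hcross : crossA p ends o a₁ a₂ v b = (1 - γ) ^ 2 * n₀ * C₀ := by
      unfold crossA anticov
      rw [mass_Q p ends h ha₁ ha₂, mass_vHoLbL_AA p ends h ha₁ hb ho ha₂ hv,
        mass_bL p ends h ha₁ hb ha₂, mass_oHbL p ends h ha₁ ho ha₂ hv, mass_bL p ends h ha₁ ho ha₂,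
        mass_oH p ends h ha₁ ha₂ hv, mass_oHbL p ends h ha₁ hb ha₂ hv, vanish, vanish, vanish, hα]
      ring
    rw [hcross]
    exact mul_nonneg (mul_nonneg (sq_nonneg _) hn0) hC0

/-- **`0 ≤ crossAA` across a cut vertex separating `{a₁, b, o}` from `{a₂, v}`** — (AA0) on the
class. -/
theorem crossAA_nonneg_of_cut (hp : IsProbVec p) (h : CutV.IsCut ends z VA VB EA EB)
    {a₁ a₂ b o v : V} (ha₁ : a₁ ∈ VA) (hb : b ∈ VA) (ho : o ∈ VA) (ha₂ : a₂ ∈ VB) (hv : v ∈ VB) :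
    0 ≤ crossAA p ends o a₁ a₂ v b := by
  unfold crossAA
  rw [crossA'_eq p ends h ha₁ hb ho ha₂ hv]
  exact add_nonneg (crossA_nonneg_of_cut p ends hp h ha₁ hb ho ha₂ hv)
    (mul_nonneg (prob_nonneg hp _) (mul_nonneg (prob_nonneg hp _) (prob_nonneg hp _)))

/-- **Row (LEAF-½) across a cut vertex separating `{a₁, b, o}` from `{a₂, v}`.** -/
theorem LeafRow_of_cut_AAB (hp : IsProbVec p) (h : CutV.IsCut ends z VA VB EA EB)
    {a₁ a₂ b o v : V} (ha₁ : a₁ ∈ VA) (hb : b ∈ VA) (ho : o ∈ VA) (ha₂ : a₂ ∈ VB) (hv : v ∈ VB) :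
    LeafRow p ends o a₁ a₂ v b :=
  LeafRow_of_AA0 p ends hp o a₁ a₂ v b (crossAA_nonneg_of_cut p ends hp h ha₁ hb ho ha₂ hv)

/-- **The root mirror**: a cut vertex `z` separating `{a₂, b, o}` from `{a₁, v}` also gives the row. -/
theorem LeafRow_of_cut_AAB' (hp : IsProbVec p) (h : CutV.IsCut ends z VA VB EA EB)
    {a₁ a₂ b o v : V} (ha₂ : a₂ ∈ VA) (hb : b ∈ VA) (ho : o ∈ VA) (ha₁ : a₁ ∈ VB) (hv : v ∈ VB) :
    LeafRow p ends o a₁ a₂ v b :=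
  (LeafRow_root_swap p ends o a₁ a₂ v b).1 (LeafRow_of_cut_AAB p ends hp h ha₂ hb ho ha₁ hv)

end CutLeafRowAAB

end Summit.Ventures.PercRepro2
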